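import Summits.Langlands.Langlands.Theorems.IrreducibilityBySelfDualityReciprocityUpToIrreducibilityArtinSector
import Summits.Langlands.Langlands.Theorems.IrreducibilityBySelfDualityReciprocityUpToIrreducibilityAbovePotentiallyUnramified
import HarnessLib

/-!
# Line `Sketch` for the crux `ReciprocityUpToIrreducibility` (item stmt-Langlands-14328), continuation c8:
# the Artin sector of `Corresponds` in every rank WITHOUT "unramified above `ℓ`", relative to the pinned datum

Support file (closes nothing; `--supports stmt-Langlands-14328`; registered stub
`stub_corresponds_iff_localMatching_of_aboveClause` of the checked skeleton `Lines/Sketch.lean` §1o).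
c8's `corresponds_iff_localMatching_of_isOpen_ker` (`…ArtinSector`) read the summit's `Corresponds` on open-kernel
`ρ` UNRAMIFIED ABOVE `ℓ` as "Satake a.e. + the classical local matching at every place".  With the N9-C iff
(`localGlobalCompatibleAt_above_iff_of_forall_isEquivalent`, worker C) the restriction above `ℓ` is replaced by
the behaviour a clause (F9) would pin, taken as a hypothesis ON THE PAIR at each `v ∣ ℓ`: every Weil–Deligne representation the pinned datum
attaches to `ρ|_{Γ_{K_v}}` is `≅ (ρ|_{W_{K_v}}, 0)` (that one IS attached, and that `ρ` is de Rham above `ℓ`, are now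
THEOREMS: since D1, 2026-08-17, the period ring of the pinned datum is `B_dR(K_v)` and finite-image representations are
de Rham for it unconditionally — §0 of this file).
So, in every rank and for every `Rec`: `Corresponds` on the whole Artin sector = Satake–Frobenius a.e. + the
classical `ℓ`-blind matching everywhere (`corresponds_iff_localMatching_of_aboveClause`), and (B) restricted to
the Artin sector reads as the strong Artin conjecture with full local matching
(`artinSector_of_galoisToAutomorphic_of_aboveClause`; geometricity is automatic, `isGeometricFramed_of_isOpen_ker'`).
No definitions; std axioms; no named fact (not even `FontaineDatumExists`).
-/

noncomputable section

set_option linter.dupNamespace false -- project-wide option (lakefile weak.linter.dupNamespace); `Summit.Langlands.Langlands` is the mandated namespace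

open scoped MatrixGroups Matrix NumberField Classical
open Filter IsDedekindDomain Field
open Literature.NumberTheory.Automorphic Literature.NumberTheory.GaloisRepresentations
open Literature.NumberTheory.PAdicHodge
open Summit.Langlands

namespace Summit.Langlands.Langlands.Theorems.ReciprocityUpToIrreducibility

variable {K : Type} [Field K] [NumberField K] {ℓ : ℕ} [Fact ℓ.Prime] {n : ℕ}
  {hcpt : isCompact_glFiniteIntegralLevel n K}

/-! ## 0. After D1: open-kernel representations are pinned-geometric in every rank, unconditionally -/

/-- An open-kernel representation of `Γ_K` (compact) has finite image. [folklore] -/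
theorem finite_range_of_isOpen_ker {A : Type*} [CommRing A] [TopologicalSpace A] {m : ℕ}
    (ρ : FramedGaloisRep K A m) (hker : IsOpen (ρ.toMonoidHom.ker : Set (absoluteGaloisGroup K))) :
    (Set.range ρ).Finite := by
  haveI : DiscreteTopology (absoluteGaloisGroup K ⧸ ρ.toMonoidHom.ker) := QuotientGroup.discreteTopology hker
  haveI : Finite (absoluteGaloisGroup K ⧸ ρ.toMonoidHom.ker) := finite_of_compact_of_discrete
  have hfin : (ρ.toMonoidHom.range : Set (GL (Fin m) A)).Finite :=
    Set.finite_coe_iff.mp (Finite.of_equiv _ (QuotientGroup.quotientKerEquivRange ρ.toMonoidHom).toEquiv)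
  simpa [MonoidHom.coe_range] using hfin

/-- … hence so has its localisation at any place `v` (`ρ|_{Γ_{K_v}} = ρ ∘ res`). [folklore] -/
theorem finite_range_toLocal_of_isOpen_ker {A : Type*} [CommRing A] [TopologicalSpace A] {m : ℕ}
    (ρ : FramedGaloisRep K A m) (hker : IsOpen (ρ.toMonoidHom.ker : Set (absoluteGaloisGroup K)))
    (v : HeightOneSpectrum (𝓞 K)) : (Set.range (ρ.toLocal v)).Finite := by
  refine (finite_range_of_isOpen_ker ρ hker).subset ?_
  rintro _ ⟨σ, rfl⟩
  exact ⟨absGaloisRestrict K (v.adicCompletion K) σ, (FramedGaloisRep.toLocal_apply v ρ σ).symm⟩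

/-- **Open-kernel representations are de Rham above `ℓ` for THE pinned datum — unconditionally** (D1, 2026-08-17: the
period ring of `fontainePstAdicCompletion v ℓ hv` IS `B_dR(K_v)`, and finite-image representations are `B_dR`-admissible,
`fontainePstAdicCompletion_isDeRhamFramed_of_finite_range`). [cite: FontaineAsterisque223III, Exp. III §1.5 and §3]
[cite: FontaineMazurGeometric1995, §1] -/
theorem isDeRhamFramed_toLocal_of_isOpen_ker {m : ℕ} (ρ : FramedGaloisRep K (PadicAlgCl ℓ) m)
    (hker : IsOpen (ρ.toMonoidHom.ker : Set (absoluteGaloisGroup K)))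
    (v : HeightOneSpectrum (𝓞 K)) (hv : ((ℓ : ℕ) : 𝓞 K) ∈ v.asIdeal) :
    (fontainePstAdicCompletion v ℓ hv).IsDeRhamFramed (ρ.toLocal v) :=
  fontainePstAdicCompletion_isDeRhamFramed_of_finite_range v ℓ hv (ρ.toLocal v)
    (finite_range_toLocal_of_isOpen_ker ρ hker v)

/-- **Open-kernel (Artin-type) representations are geometric for the summit's pinned datum, in every rank, for every
`Rec`, unconditionally**: unramified almost everywhere (`FramedGaloisRep.eventually_isUnramifiedAt_of_isOpen_ker`) and de
Rham at EVERY `v ∣ ℓ` (`isDeRhamFramed_toLocal_of_isOpen_ker`) — c8's `isGeometricFramed_of_isOpen_ker` without the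
hypothesis "unramified above `ℓ`". [cite: FontaineMazurGeometric1995, §1] [cite: FontaineAsterisque223III, Exp. III §3] -/
theorem isGeometricFramed_of_isOpen_ker' {m : ℕ} (Rec : ReciprocityData K) (ρ : FramedGaloisRep K (PadicAlgCl ℓ) m)
    (hker : IsOpen (ρ.toMonoidHom.ker : Set (absoluteGaloisGroup K))) : IsGeometricFramed Rec ρ :=
  ⟨ρ.eventually_isUnramifiedAt_of_isOpen_ker hker, fun v hv => isDeRhamFramed_toLocal_of_isOpen_ker ρ hker v hv⟩

/-- Some Weil–Deligne representation is attached by THE datum to the localisation above `ℓ` of an open-kernel `ρ`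
(de Rham ⇒ attached, structure axiom `exists_of_isDeRham`). [cite: FontaineAsterisque223VIII, §2.3.7] -/
theorem exists_isWeilDeligneOf_toLocal_of_isOpen_ker {m : ℕ} (ρ : FramedGaloisRep K (PadicAlgCl ℓ) m)
    (hker : IsOpen (ρ.toMonoidHom.ker : Set (absoluteGaloisGroup K)))
    (v : HeightOneSpectrum (𝓞 K)) (hv : ((ℓ : ℕ) : 𝓞 K) ∈ v.asIdeal) :
    ∃ r, (fontainePstAdicCompletion v ℓ hv).IsWeilDeligneOf (ρ.toLocal v) r :=
  (isDeRhamFramed_toLocal_of_isOpen_ker ρ hker v hv).exists_isWeilDeligneOf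

/-! ## 1. The clause and `Corresponds` relative to the Weil–Deligne normalisation alone -/

/-- **Every finite place, open-kernel `ρ`, relative to the pinned datum above `ℓ`: the summit's clause is the
`ℓ`-blind local matching** (`v ∤ ℓ`: c7's finite-inertia iff, unconditionally; `v ∣ ℓ`: the N9-C iff under the
pair hypotheses `hex`/`huniq`). [cite: TateCorvallis1979, (4.1.3)–(4.2.1)] [cite: FontaineAsterisque223VIII, §2.3.7] -/
theorem localGlobalCompatibleAt_iff_localMatching_of_aboveClause
    (Rec : ReciprocityData K) (ι : PadicAlgCl ℓ ≃+* ℂ)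
    (π : AutomorphicRepData (AutomorphyDatum.gl n K hcpt)) (ρ : FramedGaloisRep K (PadicAlgCl ℓ) n)
    (hker : IsOpen (ρ.toMonoidHom.ker : Set (absoluteGaloisGroup K))) (v : HeightOneSpectrum (𝓞 K))
    (hWD : ∀ hv : ((ℓ : ℕ) : 𝓞 K) ∈ v.asIdeal,
      ∀ r, (fontainePstAdicCompletion v ℓ hv).IsWeilDeligneOf (ρ.toLocal v) r →
        r.IsEquivalent (WeilDeligneRep.ofRep ((ρ.toLocal v).weilRestrict (v.adicCompletion K))
          (isContinuousRep_weilRestrict_toLocal_of_isOpen_ker ρ hker v))) :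
    LocalGlobalCompatibleAt Rec ι π ρ v ↔
      ∃ (πv : SmoothIrrep (GL (Fin n) (v.adicCompletion K)))
        (rℂ : WeilDeligneRep (v.adicCompletion K) ℂ (Fin n → ℂ)),
        π.HasLocalComponentAt v πv.ρ ∧
          (WeilDeligneRep.ofRep ((ρ.toLocal v).weilRestrict (v.adicCompletion K))
            (isContinuousRep_weilRestrict_toLocal_of_isOpen_ker ρ hker v)).IsTransportAlong
              (ι : PadicAlgCl ℓ →+* ℂ) rℂ ∧
          rℂ.HasFrobSemisimpleClass ((Rec.llc v).recGL n (IrrClass.mk πv)) := by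
  by_cases hv : ((ℓ : ℕ) : 𝓞 K) ∈ v.asIdeal
  · exact localGlobalCompatibleAt_above_iff_of_forall_isEquivalent Rec ι π ρ hv
      (exists_isWeilDeligneOf_toLocal_of_isOpen_ker ρ hker v hv) (hWD hv)
  · exact localGlobalCompatibleAt_away_iff_of_isContinuousRep Rec ι π ρ hv
      (isContinuousRep_weilRestrict_toLocal_of_isOpen_ker ρ hker v)

/-- **`Corresponds` on the WHOLE Artin sector, every rank, every `Rec`, relative to the pinned datum above `ℓ`:
Satake–Frobenius matching a.e. + the classical local matching at EVERY finite place.**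
[cite: BuzzardGeeLMS2014, Conj. 3.2.1–3.2.2] [cite: HarrisTaylorAMS2001, Thm. A] -/
theorem corresponds_iff_localMatching_of_aboveClause
    (Rec : ReciprocityData K) (ι : PadicAlgCl ℓ ≃+* ℂ)
    (π : AutomorphicRepData (AutomorphyDatum.gl n K hcpt)) (ρ : FramedGaloisRep K (PadicAlgCl ℓ) n)
    (hker : IsOpen (ρ.toMonoidHom.ker : Set (absoluteGaloisGroup K)))
    (hWD : ∀ (v : HeightOneSpectrum (𝓞 K)) (hv : ((ℓ : ℕ) : 𝓞 K) ∈ v.asIdeal),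
      ∀ r, (fontainePstAdicCompletion v ℓ hv).IsWeilDeligneOf (ρ.toLocal v) r →
        r.IsEquivalent (WeilDeligneRep.ofRep ((ρ.toLocal v).weilRestrict (v.adicCompletion K))
          (isContinuousRep_weilRestrict_toLocal_of_isOpen_ker ρ hker v))) :
    Corresponds Rec ι π ρ ↔
      (∀ᶠ v : HeightOneSpectrum (𝓞 K) in cofinite, SatakeFrobCompatibleAt ι π ρ v) ∧
      ∀ v : HeightOneSpectrum (𝓞 K),
        ∃ (πv : SmoothIrrep (GL (Fin n) (v.adicCompletion K)))
          (rℂ : WeilDeligneRep (v.adicCompletion K) ℂ (Fin n → ℂ)),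
          π.HasLocalComponentAt v πv.ρ ∧
            (WeilDeligneRep.ofRep ((ρ.toLocal v).weilRestrict (v.adicCompletion K))
              (isContinuousRep_weilRestrict_toLocal_of_isOpen_ker ρ hker v)).IsTransportAlong
                (ι : PadicAlgCl ℓ →+* ℂ) rℂ ∧
            rℂ.HasFrobSemisimpleClass ((Rec.llc v).recGL n (IrrClass.mk πv)) :=
  and_congr_right fun _ => forall_congr' fun v =>
    localGlobalCompatibleAt_iff_localMatching_of_aboveClause Rec ι π ρ hker v (hWD v)

/-- **Registered stub (c8, §1o): `Corresponds` on the whole Artin sector relative to the pinned datum above `ℓ`**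
— the registered name for `corresponds_iff_localMatching_of_aboveClause`.
[cite: BuzzardGeeLMS2014, Conj. 3.2.1–3.2.2] [cite: HarrisTaylorAMS2001, Thm. A] -/
theorem stub_corresponds_iff_localMatching_of_aboveClause :
    ∀ (K : Type) [Field K] [NumberField K] (ℓ : ℕ) [Fact ℓ.Prime] (n : ℕ)
      (hcpt : isCompact_glFiniteIntegralLevel n K) (Rec : ReciprocityData K) (ι : PadicAlgCl ℓ ≃+* ℂ)
      (π : AutomorphicRepData (AutomorphyDatum.gl n K hcpt)) (ρ : FramedGaloisRep K (PadicAlgCl ℓ) n)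
      (hker : IsOpen (ρ.toMonoidHom.ker : Set (Field.absoluteGaloisGroup K))),
      (∀ (v : HeightOneSpectrum (𝓞 K)) (hv : ((ℓ : ℕ) : 𝓞 K) ∈ v.asIdeal),
        ∀ r, (Literature.NumberTheory.PAdicHodge.fontainePstAdicCompletion v ℓ hv).IsWeilDeligneOf (ρ.toLocal v) r →
          r.IsEquivalent (WeilDeligneRep.ofRep ((ρ.toLocal v).weilRestrict (v.adicCompletion K))
            (isContinuousRep_weilRestrict_toLocal_of_isOpen_ker ρ hker v))) →
      (Corresponds Rec ι π ρ ↔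
        (∀ᶠ v : HeightOneSpectrum (𝓞 K) in cofinite, SatakeFrobCompatibleAt ι π ρ v) ∧
        ∀ v : HeightOneSpectrum (𝓞 K),
          ∃ (πv : SmoothIrrep (GL (Fin n) (v.adicCompletion K)))
            (rℂ : WeilDeligneRep (v.adicCompletion K) ℂ (Fin n → ℂ)),
            π.HasLocalComponentAt v πv.ρ ∧
              (WeilDeligneRep.ofRep ((ρ.toLocal v).weilRestrict (v.adicCompletion K))
                (isContinuousRep_weilRestrict_toLocal_of_isOpen_ker ρ hker v)).IsTransportAlong
                  (ι : PadicAlgCl ℓ →+* ℂ) rℂ ∧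
              rℂ.HasFrobSemisimpleClass ((Rec.llc v).recGL n (IrrClass.mk πv))) :=
  fun _ _ _ _ _ _ _ Rec ι π ρ hker hWD => corresponds_iff_localMatching_of_aboveClause Rec ι π ρ hker hWD

/-- **(B) on the whole Artin sector, read classically, relative to the pinned datum above `ℓ`** (every rank,
every `Rec`): for an irreducible open-kernel `ρ` which is de Rham above `ℓ` for the pinned datum and satisfies the
pair hypotheses there, `GaloisToAutomorphic n Rec hcpt` yields an L-algebraic cuspidal `π` with Satake matching
a.e. and the classical local matching at EVERY place. [cite: FontaineMazurGeometric1995, Conj. 1]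
[cite: BuzzardGeeLMS2014, Conj. 3.2.2 and §5] -/
theorem artinSector_of_galoisToAutomorphic_of_aboveClause {hcpt : isCompact_glFiniteIntegralLevel n K}
    {Rec : ReciprocityData K} (hB : GaloisToAutomorphic n Rec hcpt) (ι : PadicAlgCl ℓ ≃+* ℂ)
    (ρ : FramedGaloisRep K (PadicAlgCl ℓ) n) (hker : IsOpen (ρ.toMonoidHom.ker : Set (absoluteGaloisGroup K)))
    (hWD : ∀ (v : HeightOneSpectrum (𝓞 K)) (hv : ((ℓ : ℕ) : 𝓞 K) ∈ v.asIdeal),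
      ∀ r, (fontainePstAdicCompletion v ℓ hv).IsWeilDeligneOf (ρ.toLocal v) r →
        r.IsEquivalent (WeilDeligneRep.ofRep ((ρ.toLocal v).weilRestrict (v.adicCompletion K))
          (isContinuousRep_weilRestrict_toLocal_of_isOpen_ker ρ hker v)))
    (hirr : ρ.toGaloisRep.IsIrreducible) :
    ∃ π : CuspidalAutomorphicRepData n K hcpt, π.1.IsLAlgebraic ∧
      (∀ᶠ v : HeightOneSpectrum (𝓞 K) in cofinite, SatakeFrobCompatibleAt ι π.1 ρ v) ∧
      ∀ v : HeightOneSpectrum (𝓞 K),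
        ∃ (πv : SmoothIrrep (GL (Fin n) (v.adicCompletion K)))
          (rℂ : WeilDeligneRep (v.adicCompletion K) ℂ (Fin n → ℂ)),
          π.1.HasLocalComponentAt v πv.ρ ∧
            (WeilDeligneRep.ofRep ((ρ.toLocal v).weilRestrict (v.adicCompletion K))
              (isContinuousRep_weilRestrict_toLocal_of_isOpen_ker ρ hker v)).IsTransportAlong
                (ι : PadicAlgCl ℓ →+* ℂ) rℂ ∧
            rℂ.HasFrobSemisimpleClass ((Rec.llc v).recGL n (IrrClass.mk πv)) := by
  have hgeo : IsGeometricFramed Rec ρ := isGeometricFramed_of_isOpen_ker' Rec ρ hker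
  obtain ⟨π, hL, hcorr⟩ := hB ℓ ι ρ hirr hgeo
  exact ⟨π, hL, (corresponds_iff_localMatching_of_aboveClause Rec ι π.1 ρ hker hWD).mp hcorr⟩

/-- **(A) on the whole Artin sector from the classical data, relative to the pinned datum above `ℓ`** (every
rank, every `Rec`): Satake a.e. + classical local matching everywhere + de Rham above `ℓ` make an irreducible
open-kernel `ρ` a geometric correspondent of `π`, unique up to conjugacy among all correspondents.
[cite: BuzzardGeeLMS2014, Conj. 3.2.1–3.2.2] [cite: HarrisTaylorAMS2001, Thm. A] -/
theorem automorphicToGalois_artinSector_of_localMatching_of_aboveClause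
    (Rec : ReciprocityData K) (ι : PadicAlgCl ℓ ≃+* ℂ)
    (π : AutomorphicRepData (AutomorphyDatum.gl n K hcpt)) (ρ : FramedGaloisRep K (PadicAlgCl ℓ) n)
    (hker : IsOpen (ρ.toMonoidHom.ker : Set (absoluteGaloisGroup K)))
    (hWD : ∀ (v : HeightOneSpectrum (𝓞 K)) (hv : ((ℓ : ℕ) : 𝓞 K) ∈ v.asIdeal),
      ∀ r, (fontainePstAdicCompletion v ℓ hv).IsWeilDeligneOf (ρ.toLocal v) r →
        r.IsEquivalent (WeilDeligneRep.ofRep ((ρ.toLocal v).weilRestrict (v.adicCompletion K))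
          (isContinuousRep_weilRestrict_toLocal_of_isOpen_ker ρ hker v)))
    (hirr : ρ.toGaloisRep.IsIrreducible)
    (hae : ∀ᶠ v : HeightOneSpectrum (𝓞 K) in cofinite, SatakeFrobCompatibleAt ι π ρ v)
    (hloc : ∀ v : HeightOneSpectrum (𝓞 K),
      ∃ (πv : SmoothIrrep (GL (Fin n) (v.adicCompletion K)))
        (rℂ : WeilDeligneRep (v.adicCompletion K) ℂ (Fin n → ℂ)),
        π.HasLocalComponentAt v πv.ρ ∧
          (WeilDeligneRep.ofRep ((ρ.toLocal v).weilRestrict (v.adicCompletion K))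
            (isContinuousRep_weilRestrict_toLocal_of_isOpen_ker ρ hker v)).IsTransportAlong
              (ι : PadicAlgCl ℓ →+* ℂ) rℂ ∧
          rℂ.HasFrobSemisimpleClass ((Rec.llc v).recGL n (IrrClass.mk πv))) :
    ρ.toGaloisRep.IsIrreducible ∧ IsGeometricFramed Rec ρ ∧ Corresponds Rec ι π ρ ∧
      ∀ ρ' : FramedGaloisRep K (PadicAlgCl ℓ) n, Corresponds Rec ι π ρ' → IsConjugate ρ ρ' :=
  ⟨hirr, isGeometricFramed_of_isOpen_ker' Rec ρ hker,
    (corresponds_iff_localMatching_of_aboveClause Rec ι π ρ hker hWD).mpr ⟨hae, hloc⟩,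
    fun _ hρ' => isConjugate_of_satakeFrobCompatibleAt π ι hirr hae hρ'.1⟩

end Summit.Langlands.Langlands.Theorems.ReciprocityUpToIrreducibility

end
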